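import Summits.AnomalousDissipation.AnomalousDissipation.Theorems.SolenoidalFractalHomogenisationLagrangianStepWCrossingWindow
import Summits.AnomalousDissipation.AnomalousDissipation.Theorems.SolenoidalFractalHomogenisationLagrangianStepSidebandDefs
import HarnessLib

/-!
# K1L_D `stub_cellLawV0_IS` / `stub_D1_exactFamily` — A0: the NAMED exact family `ΨB₁` of the D1 split (registry v16) and its residue window `νB₁`
# (shared definitions; reviewed; `--kind definition --supports stmt-AnomalousDissipation-27980 --as helper`)

Summits-side DEFINITIONS file of route `SolenoidalFractalHomogenisation` (prover seat `ad-sawtooth-k1loc-p1` g12; tenure planner ad-ideate-p1 g26 request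
2026-08-29T01:37:15Z «A0», constraints (α)(β) of 01:24:03Z; definition of record of the exact family D26-3 = `Sideband.psiStar`, prover ad-k1l-cellLawV-w1 g5,
p682189).  The D1 split (`…LagrangianStepD1Split`, p686447: `pieceFamily`, `D1ExactFamilyB_of_split`) consumes ONE named family serving both clause (i)
(residue, on `ν ∈ (0, νB₁]`) and clause (ii) (V0):
* **`ΨB₁ a ν := a • Sideband.psiStar cubatureWord MB MB_pos ν`** — normalisation `â = 1`.  WHY `â = 1` (derivation, to be landed as the identification
  theorem A1(c) of the sizing memo `HOME/ad-sawtooth-k1loc-p1/D1i-sizing-v2-k1locp1g12.md`): for `W₁ = (cubatureWord.stretch MB).stretch (1/ν)`, `𝔸 = ν•S`,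
  during slot `j` the sidebands `±mⱼ` do not spread (`êⱼ·mⱼ = 0`), the transversal block generator there is `−4π²·P T_{(νS)ᵀ}(mⱼ) P = −4π²ν|mⱼ|²·B̂ⱼ`
  (`B̂ⱼ = regBlock S m̂ⱼ`, `T_{𝔸ᵀ}(m) = ν|m|²·Σ(S, m̂)`), the source injects `−2πi·envⱼ·αⱼ P v` at `mⱼ` (`ᾱⱼ` at `−mⱼ`) and the feedback reads
  `2πi·envⱼ·(αⱼ y_{−mⱼ} + ᾱⱼ y_{mⱼ})`, so `feedbackⱼ ∘ responseⱼ = 4π²·2|αⱼ|²·envⱼ(t)·∫ envⱼ(s) e^{−4π²ν|mⱼ|²(t−s)B̂ⱼ} P ds`, `|αⱼ|² = 1/(16π²|mⱼ|²)`;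
  in slot time (`t = start + (MB τⱼ/ν)·u`, `4π²ν|mⱼ|²·MBτⱼ/ν = Tⱼ`) the period mean is `M_{jj} = τⱼ/(ν·8π²|mⱼ|⁴·3720) · qsResp(½, Tⱼ, B̂ⱼ) Pⱼ`, and with
  `psiStar`'s prefactor `ν/(4π²)` the diagonal of `psiStar` is `Σⱼ τⱼ/(32π⁴|mⱼ|⁴·3720) · (êⱼ ⊗ êⱼ) ⊗ Qⱼ(S) = excQS cubatureWord MB S` EXACTLY
  (`slotCoef cubatureWord j = τⱼ/(2(2π|mⱼ|)⁴·3720)`, `excQS_apply`).  Hence the residue `ΨB₁ a ν S − ΦB a S` is `a •` (the 13 colinear adjacent pair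
  memory terms + `e^{−Tb}` tails), of relative size ≈ 1e-4 (p5 j321687: 8.62e-5; CERT-(i) v0 bound 1.108e-4 ≤ ρB);
* **`νB₁ := 1/40`** — the residue range `(0, νB₁]` of `stub_D1_residue`.  Any positive value would do for the identification (it is `ν`-free); `1/40`
  makes the off-slot decay rate of `Sideband.norm_response_le_exp_of_envelope_zero` (`min γ₁ (4π²·lo')`, `γ₁ = 1`, `lo' = (10/11)ν` for `𝔸 = ν•S`,
  `NearIso S (10/11) (11/10)`) equal to the viscous rate `4π²(10/11)ν ≤ 4π²/44 < 1` on the whole range, so every memory / wrap-around tail of the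
  residue is `exp(−(10/11)·4π²·MB·τ_gap)`-small uniformly in `ν ∈ (0, νB₁]` (slot lengths are `MBτ/ν`); (ii)'s own `ν₀` is existential and independent
  (the split cuts it down to `min ν₀ νB₁`).
Definitions + unfolding/positivity lemmas only; no theorem of substance, no named fact, no sorry.  NOT a proof of anything; rung leaf F-D1.A0; AD not claimed.
-/

set_option linter.dupNamespace false

noncomputable section

namespace Summit.AnomalousDissipation.AnomalousDissipation.Theorems.SolenoidalFractalHomogenisation.LagrangianStep.WCrossing

open Summit.AnomalousDissipation.AnomalousDissipation.Theorems
open Literature.Analysis Literature.Analysis.FluidPDE Literature.Analysis.FunctionSpaces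

/-- **The named exact family of the D1 split** (registry v16): `ΨB₁ a ν := a • Sideband.psiStar cubatureWord MB MB_pos ν` (normalisation `â = 1`: the
diagonal of `psiStar` is `excQS cubatureWord MB` exactly — see the module docstring; off `ν > 0` it is `0` by `Sideband.psiStar_of_not_pos`, the split
`pieceFamily` replaces it by `ΦB a` there). [cite: MajdaKramer1999, §2.2.1.3 (55) (effective diffusivity as a cell average)] -/
def ΨB₁ (a ν : ℝ) : T4 → T4 := fun S => a • Sideband.psiStar cubatureWord MB MB_pos ν S

/-- **The residue window** `(0, νB₁]` of `stub_D1_residue`: `νB₁ = 1/40` (so that `4π²·(10/11)·ν ≤ 1 = γ₁` on the window: the off-slot decay rate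
of the sideband responses is the viscous one, uniformly). [cite: MajdaKramer1999, §2.2.1.3] -/
def νB₁ : ℝ := 1 / 40

/-- `0 < νB₁`. [folklore] -/
theorem νB₁_pos : 0 < νB₁ := by unfold νB₁; norm_num

/-- `νB₁ ≤ 1`. [folklore] -/
theorem νB₁_le_one : νB₁ ≤ 1 := by unfold νB₁; norm_num

/-- On the residue window the viscous rate is below the longitudinal one: `4π²·(10/11)·ν ≤ 1` for `ν ≤ νB₁` (uses `π < 3.15`). [folklore] -/
theorem viscRate_le_one {ν : ℝ} (hν : ν ≤ νB₁) : 4 * Real.pi ^ 2 * (10 / 11 * ν) ≤ 1 := by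
  unfold νB₁ at hν
  have hπ := Real.pi_lt_d2
  have hπ0 := Real.pi_pos
  nlinarith [mul_pos hπ0 hπ0]

/-- Unfolding `ΨB₁`. [folklore] -/
theorem ΨB₁_apply (a ν : ℝ) (S : T4) : ΨB₁ a ν S = a • Sideband.psiStar cubatureWord MB MB_pos ν S := rfl

/-- Off `ν > 0` the family vanishes (so the split's `pieceFamily` is the object clause (i) speaks about on `(0, νB₁]` only). [folklore] -/
theorem ΨB₁_of_not_pos (a : ℝ) {ν : ℝ} (hν : ¬ 0 < ν) (S : T4) : ΨB₁ a ν S = 0 := by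
  rw [ΨB₁_apply, Sideband.psiStar_of_not_pos _ _ _ hν]
  funext i a' j b
  simp

/-- `ΨB₁` is linear in the normalisation `a`. [folklore] -/
theorem ΨB₁_smul (a b ν : ℝ) (S : T4) : ΨB₁ (a * b) ν S = a • ΨB₁ b ν S := by
  rw [ΨB₁_apply, ΨB₁_apply, mul_smul]

end Summit.AnomalousDissipation.AnomalousDissipation.Theorems.SolenoidalFractalHomogenisation.LagrangianStep.WCrossing
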